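import Summits.ValiantsHypothesis.ValiantsHypothesis.Theorems.BarrierLeverAnchoredDoorHitsLowerPairsThinStepSpec

/-!
# Support item `AnchoredDoorHitsLowerPairs` (stmt-ValiantsHypothesis-22510), line `anchored-peeling`:
# THE LEF (PARTNER) MOVE — a kernel-checked reduction of the vertex step to ONE specialised member

Helper file (`--supports stmt-ValiantsHypothesis-22510`; cell valiant-natproofs, rung V4, 𝒟-side door (c); registered line
`Cruxes/AnchoredDoorHitsLowerPairs/Lines/anchored_peeling.lean` v5, open stub `stub_vertexStep`; prover seat val-np-p2 gen 11). Bookkeeping `def`s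
`isVtx`, `lefSpec`, `lefHom`, `gl`, `lefEntry`. Closes NO item.

THE MOVE (seat memo HOME/val-np-p2/g11/TU1-GAME-valnp2-g11.md §6; it is val-np-p1 g16's «E + Y» operator with a GENERIC inner door). Fix an
`x`-vertex `a` and a partner map `π : Fin h → Fin h`. Specialise the anchors of `a`: `θ_{(a|c)} ↦ 1`, `ψ_{(a|c),d} ↦ 0`, and ONE kind of `x`-twist,
`φ_{(a|c),b} ↦ [π b = c]`; kill every other anchor whose `x`-part contains `a` and every twist onto `x_a`; keep all other parameters. Then the
specialised witness is `F₀ · ∏_c (1 + x_a · gl c)` (`map_lefHom_symbolicWitness`) with `F₀` = the witness with `x_a` killed (part 1 of the thin step)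
and `gl c = y_c · Σ_{Z ⊆ π⁻¹(c) ∖ a} x^Z`, and its layout matrix is `lefEntry` (`coeff_map_lefHom`):
* deletion rows (`a ∉ U`): the symbolic entries `[x^U y^W'] 𝔄` themselves;
* link rows (`a ∈ U`, `S₁ = U ∖ a`): `Σ_c Σ_{Z ⊆ π⁻¹(c) ∖ a} [Z ⊆ S₁][c ∈ W'] · [x^{S₁ ∖ Z} y^{W' ∖ c}] 𝔄`
  (for injective `π`: `ℓ·ρ′_{S₁} + Σ_{b ∈ S₁} y_{π b}·ρ′_{S₁∖b}`, `ℓ = Σ_c y_c`; for the diagonal inner door: `E + Y`).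
**THEOREM (`symbolicDet_ne_zero_of_lef`).** If `det (lefEntry) ≠ 0` then `symbolicDet s h r u w ≠ 0` (every `s ≥ 1`, every `h`, any `π`; no
lower-set hypothesis). NUMERICS (memo §6): for injective `π` the matrix IS nonsingular at EVERY vertex of EVERY random lower pair tested ((4,4) 300,
(4,5) 300, (5,5) 150, (5,6) 100 pairs; ≤ 6 random `π` each; 0 failures) and on all known thick cores ((K_5, 2^[4]), cube-vs-ball, P_4 at apex and base,
dense (4,4) cores) — configurations where the star / thin moves have NO move. CONJECTURE LEF: for every injective lower pair and every vertex some
injective `π` works; LEF ⟹ `stub_vertexStep` (via this file).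

WHAT THIS IS NOT: `det (lefEntry) ≠ 0` is NOT proved here (it mixes rows of `𝔄` with `q`-multiples of rows, so it is not a minor of the deletion
door); nothing on items 22510 / 19717 themselves, on crux stmt-ValiantsHypothesis-14610, or on `VP` versus `VNP`.
-/

set_option linter.dupNamespace false

namespace Summit.ValiantsHypothesis.ValiantsHypothesis.Theorems.BarrierLever.AnchoredPeeling

open Finset MvPolynomial
open Summit.ValiantsHypothesis.ValiantsHypothesis.Theorems.BarrierLever.BrickCalculus
  (pexpo pexpo_def pexpo_le_iff pexpo_sub pexpo_apply_castAdd pexpo_apply_natAdd)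

noncomputable section

namespace ThinStep

variable {h : ℕ}

/-! ## 1. The specialisation -/

/-- Vertex anchors of `a`: `α = ({a}, {c})` for some `c`. -/
def isVtx (a : Fin h) (α : Finset (Fin h) × Finset (Fin h)) : Bool :=
  decide (α.1 = {a} ∧ α.2.card = 1)

/-- Characterisation of the vertex anchors of `a`. -/
theorem isVtx_iff {a : Fin h} {α : Finset (Fin h) × Finset (Fin h)} : isVtx a α = true ↔ ∃ c, α = ({a}, {c}) := by
  simp only [isVtx, decide_eq_true_eq]
  constructor
  · rintro ⟨h1, h2⟩
    obtain ⟨c, hc⟩ := Finset.card_eq_one.mp h2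
    exact ⟨c, Prod.ext h1 hc⟩
  · rintro ⟨c, rfl⟩
    exact ⟨rfl, Finset.card_singleton c⟩

/-- `({a}, {c})` is a vertex anchor of `a`. -/
theorem isVtx_pair (a c : Fin h) : isVtx a ({a}, {c}) = true := isVtx_iff.mpr ⟨c, rfl⟩

/-- Non-vertex anchors. -/
theorem isVtx_eq_false {a : Fin h} {α : Finset (Fin h) × Finset (Fin h)} (hα : ¬ ∃ c, α = ({a}, {c})) : isVtx a α = false := by
  rw [← Bool.not_eq_true, isVtx_iff]; exact hα

/-- The LEF specialisation of the parameters at the vertex `a` with partner map `π`. -/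
def lefSpec (a : Fin h) (π : Fin h → Fin h) : Param h → MvPolynomial (Param h) ℂ
  | Sum.inl α => if isVtx a α then 1 else if a ∈ α.1 then 0 else X (Sum.inl α)
  | Sum.inr (Sum.inl (α, b)) =>
      if isVtx a α then (if α.2 = {π b} then 1 else 0) else if b = a then 0 else X (Sum.inr (Sum.inl (α, b)))
  | Sum.inr (Sum.inr (α, d)) => if isVtx a α then 0 else X (Sum.inr (Sum.inr (α, d)))

/-- The specialisation as a ring map. -/
def lefHom (a : Fin h) (π : Fin h → Fin h) : MvPolynomial (Param h) ℂ →+* MvPolynomial (Param h) ℂ :=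
  (aeval (lefSpec a π)).toRingHom

/-- The specialisation on a parameter variable. -/
theorem lefHom_X (a : Fin h) (π : Fin h → Fin h) (v : Param h) : lefHom a π (X v) = lefSpec a π v := by
  rw [lefHom, AlgHom.toRingHom_eq_coe, RingHom.coe_coe, aeval_X]

/-- The partner fibre of `c` (off `a`). -/
def fib (a : Fin h) (π : Fin h → Fin h) (c : Fin h) : Finset (Fin h) := (univ.erase a).filter (fun b => π b = c)

/-- The specialised `a`-factor polynomial of the vertex `c`: `gl c = Σ_{Z ⊆ fib c} x^Z y_c`. -/
def gl (a : Fin h) (π : Fin h → Fin h) (c : Fin h) : MvPolynomial (Fin (h + h)) (MvPolynomial (Param h) ℂ) :=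
  ∑ Z ∈ (fib a π c).powerset, monomial (pexpo Z {c}) 1

/-! ## 2. The specialised anchor factors -/

variable (a : Fin h) (π : Fin h → Fin h)

/-- `a` is not in any fibre. -/
theorem not_mem_fib (c : Fin h) : a ∉ fib a π c := fun ha =>
  Finset.notMem_erase a univ (Finset.mem_filter.mp ha).1

/-- **Vertex factor**: `map lefHom (symbFactor ({a},{c})) = 1 + x_a · gl c`. -/
theorem map_lefHom_symbFactor_vtx (c : Fin h) :
    MvPolynomial.map (lefHom a π) (symbFactor h ({a}, {c})) = 1 + X (Fin.castAdd h a) * gl a π c := by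
  classical
  have hθ : lefHom a π (X (Sum.inl ({a}, {c}))) = 1 := by
    rw [lefHom_X, lefSpec, isVtx_pair]; rfl
  have hψ : ∀ d : Fin h, lefHom a π (X (Sum.inr (Sum.inr (({a}, {c}), d)))) = 0 := by
    intro d; rw [lefHom_X, lefSpec, isVtx_pair]; rfl
  have hφ : ∀ b ∈ univ \ ({a} : Finset (Fin h)),
      (1 + C (lefHom a π (X (Sum.inr (Sum.inl (({a}, {c}), b))))) * X (Fin.castAdd h b) :
        MvPolynomial (Fin (h + h)) (MvPolynomial (Param h) ℂ)) =
      if b ∈ fib a π c then 1 + X (Fin.castAdd h b) else 1 := by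
    intro b hb
    have hba : b ≠ a := fun hba => by
      rw [Finset.mem_sdiff, Finset.mem_singleton] at hb; exact hb.2 hba
    rw [lefHom_X, lefSpec, isVtx_pair]
    simp only [↓reduceIte, Finset.singleton_inj]
    by_cases hbc : π b = c
    · have hmem : b ∈ fib a π c := Finset.mem_filter.mpr ⟨Finset.mem_erase.mpr ⟨hba, Finset.mem_univ _⟩, hbc⟩
      rw [if_pos hbc.symm, if_pos hmem, map_one, one_mul]
    · have hnm : b ∉ fib a π c := fun h' => hbc (Finset.mem_filter.mp h').2
      rw [if_neg (fun h' => hbc h'.symm), if_neg hnm, map_zero, zero_mul, add_zero]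
  rw [symbFactor]
  simp only [map_add, map_one, map_mul, map_prod, map_C, map_X, hθ, hψ, Finset.prod_singleton, map_zero, zero_mul, add_zero,
    Finset.prod_const_one, mul_one]
  rw [Finset.prod_congr rfl hφ, Finset.prod_ite, Finset.prod_const_one, mul_one]
  have hfil : (univ \ ({a} : Finset (Fin h))).filter (fun b => b ∈ fib a π c) = fib a π c := by
    ext b
    simp only [Finset.mem_filter, Finset.mem_sdiff, Finset.mem_univ, Finset.mem_singleton, true_and, and_iff_right_iff_imp]
    intro hb hba
    exact not_mem_fib a π c (hba ▸ hb)
  rw [hfil, Finset.prod_one_add, gl, Finset.mul_sum, Finset.mul_sum]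
  refine congrArg (HAdd.hAdd (1 : MvPolynomial (Fin (h + h)) (MvPolynomial (Param h) ℂ))) ?_
  refine Finset.sum_congr rfl (fun Z _ => ?_)
  have hmono : (monomial (pexpo Z {c}) (1 : MvPolynomial (Param h) ℂ) : MvPolynomial (Fin (h + h)) (MvPolynomial (Param h) ℂ)) =
      (∏ b ∈ Z, X (Fin.castAdd h b)) * X (Fin.natAdd h c) := by
    rw [← Finset.prod_singleton (fun d => (X (Fin.natAdd h d) : MvPolynomial (Fin (h + h)) (MvPolynomial (Param h) ℂ))) c,
      prod_X_eq_monomial', prod_X_eq_monomial', monomial_mul, mul_one, pexpo_def]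
  rw [hmono]
  ring

/-- **Killed `a`-anchor**: a non-vertex anchor whose `x`-part contains `a` maps to `1`. -/
theorem map_lefHom_symbFactor_kill {α : Finset (Fin h) × Finset (Fin h)} (hv : ¬ ∃ c, α = ({a}, {c})) (ha : a ∈ α.1) :
    MvPolynomial.map (lefHom a π) (symbFactor h α) = 1 := by
  rw [symbFactor]
  simp only [map_add, map_one, map_mul, map_C, lefHom_X, lefSpec, isVtx_eq_false hv, if_pos ha]
  simp

/-- **Constant anchor**: an anchor with `a ∉ A` maps to its `x_a`-free factor. -/
theorem map_lefHom_symbFactor_const {α : Finset (Fin h) × Finset (Fin h)} (ha : a ∉ α.1) :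
    MvPolynomial.map (lefHom a π) (symbFactor h α) = delFactor a α := by
  classical
  have hv : ¬ ∃ c, α = ({a}, {c}) := by
    rintro ⟨c, rfl⟩; exact ha (Finset.mem_singleton_self a)
  have hmem : a ∈ univ \ α.1 := Finset.mem_sdiff.mpr ⟨Finset.mem_univ _, ha⟩
  have h4 : (∏ b ∈ univ \ α.1, (1 + C (lefHom a π (X (Sum.inr (Sum.inl (α, b))))) * X (Fin.castAdd h b)) :
        MvPolynomial (Fin (h + h)) (MvPolynomial (Param h) ℂ)) =
      ∏ b ∈ (univ \ α.1).erase a, (1 + C (X (Sum.inr (Sum.inl (α, b)))) * X (Fin.castAdd h b)) := by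
    rw [← Finset.mul_prod_erase _ _ hmem, lefHom_X, lefSpec, isVtx_eq_false hv]
    simp only [Bool.false_eq_true, ↓reduceIte, map_zero, zero_mul, add_zero, one_mul]
    refine Finset.prod_congr rfl (fun b hb => ?_)
    rw [lefHom_X, lefSpec, isVtx_eq_false hv]
    simp only [Bool.false_eq_true, ↓reduceIte, if_neg (Finset.ne_of_mem_erase hb)]
  rw [symbFactor, delFactor]
  simp only [map_add, map_one, map_mul, map_prod, map_C, map_X]
  rw [h4, lefHom_X, lefSpec, isVtx_eq_false hv]
  simp only [Bool.false_eq_true, ↓reduceIte, if_neg ha, lefHom_X, lefSpec, isVtx_eq_false hv]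

/-- The `a`-factor attached to an anchor: `1 + x_a · gl c` for the vertex anchor `({a},{c})`, `1` otherwise. -/
def vfac (α : Finset (Fin h) × Finset (Fin h)) : MvPolynomial (Fin (h + h)) (MvPolynomial (Param h) ℂ) :=
  ∏ c ∈ (univ : Finset (Fin h)) with (({a}, {c}) : Finset (Fin h) × Finset (Fin h)) = α, (1 + X (Fin.castAdd h a) * gl a π c)

/-- **Every anchor factor specialises to (its `x_a`-killed factor) × (its `a`-factor).** -/
theorem map_lefHom_symbFactor (α : Finset (Fin h) × Finset (Fin h)) :
    MvPolynomial.map (lefHom a π) (symbFactor h α) = killVars {Fin.castAdd h a} (symbFactor h α) * vfac a π α := by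
  classical
  by_cases hv : ∃ c, α = ({a}, {c})
  · obtain ⟨c, rfl⟩ := hv
    have hfil : (univ : Finset (Fin h)).filter (fun c' => (({a}, {c'}) : Finset (Fin h) × Finset (Fin h)) = ({a}, {c})) = {c} := by
      ext c'
      simp only [Finset.mem_filter, Finset.mem_univ, true_and, Prod.mk.injEq, Finset.singleton_inj, Finset.mem_singleton]
    rw [vfac, hfil, Finset.prod_singleton, map_lefHom_symbFactor_vtx,
      killVars_symbFactor_of_mem _ _ (Finset.mem_singleton_self a) (Finset.mem_singleton_self _), one_mul]
  · have hfil : (univ : Finset (Fin h)).filter (fun c' => (({a}, {c'}) : Finset (Fin h) × Finset (Fin h)) = α) = ∅ := by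
      rw [Finset.filter_eq_empty_iff]
      intro c' _ heq
      exact hv ⟨c', heq.symm⟩
    rw [vfac, hfil, Finset.prod_empty, mul_one]
    by_cases ha : a ∈ α.1
    · rw [map_lefHom_symbFactor_kill a π hv ha, killVars_symbFactor_of_mem _ _ ha (Finset.mem_singleton_self _)]
    · rw [map_lefHom_symbFactor_const a π ha, killVars_symbFactor_castAdd_of_not_mem a α ha]

/-- **The specialised witness**: `F₀ · ∏_c (1 + x_a · gl c)` (`s ≥ 1`). -/
theorem map_lefHom_symbolicWitness {s : ℕ} (hs : 1 ≤ s) :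
    MvPolynomial.map (lefHom a π) (symbolicWitness s h) =
      killVars {Fin.castAdd h a} (symbolicWitness s h) * ∏ c : Fin h, (1 + X (Fin.castAdd h a) * gl a π c) := by
  classical
  rw [symbolicWitness_eq_prod, map_prod, map_prod,
    Finset.prod_congr rfl (fun α _ => map_lefHom_symbFactor a π α), Finset.prod_mul_distrib]
  congr 1
  have hmaps : ∀ c ∈ (univ : Finset (Fin h)), (({a}, {c}) : Finset (Fin h) × Finset (Fin h)) ∈ anchors s h := by
    intro c _
    simp only [anchors, Finset.mem_filter, Finset.mem_univ, true_and, Finset.card_singleton]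
    omega
  simp only [vfac]
  exact Finset.prod_fiberwise_of_maps_to hmaps _

/-! ## 3. The entries of the specialised layout matrix -/

/-- The LEF layout entry at row face `U` and column face `W'`. -/
def lefEntry (s : ℕ) (U W' : Finset (Fin h)) : MvPolynomial (Param h) ℂ :=
  if a ∈ U then
    ∑ c : Fin h, ∑ Z ∈ (fib a π c).powerset,
      if Z ⊆ U.erase a ∧ c ∈ W' then coeff (pexpo ((U.erase a) \ Z) (W'.erase c)) (symbolicWitness s h) else 0
  else coeff (pexpo U W') (symbolicWitness s h)

/-- **Entry formula**: the layout of the specialised witness is `lefEntry`. -/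
theorem coeff_map_lefHom {s : ℕ} (hs : 1 ≤ s) (U W' : Finset (Fin h)) :
    coeff (pexpo U W') (MvPolynomial.map (lefHom a π) (symbolicWitness s h)) = lefEntry a π s U W' := by
  classical
  obtain ⟨Q, hQ⟩ := exists_prod_one_add_X_mul (univ : Finset (Fin h)) (gl a π) (Fin.castAdd h a)
  rw [map_lefHom_symbolicWitness a π hs, hQ, lefEntry]
  set F₀ := killVars {Fin.castAdd h a} (symbolicWitness s h) with hF₀
  have hsplit : F₀ * (1 + X (Fin.castAdd h a) * ∑ c : Fin h, gl a π c + X (Fin.castAdd h a) ^ 2 * Q) =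
      F₀ + X (Fin.castAdd h a) * (F₀ * ∑ c : Fin h, gl a π c) + X (Fin.castAdd h a) ^ 2 * (F₀ * Q) := by ring
  rw [hsplit, coeff_add, coeff_add]
  by_cases haU : a ∈ U
  · rw [if_pos haU, hF₀, coeff_killVars_symbolicWitness_of_mem s h a W' haU, zero_add, coeff_X_pow_mul', if_neg, add_zero,
      coeff_X_mul', if_pos, pexpo_eq_single_add_erase W' haU, add_tsub_cancel_left, Finset.mul_sum, coeff_sum]
    · refine Finset.sum_congr rfl (fun c _ => ?_)
      rw [gl, Finset.mul_sum, coeff_sum]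
      refine Finset.sum_congr rfl (fun Z hZ => ?_)
      rw [coeff_mul_monomial', mul_one]
      have haZ : a ∉ (U.erase a) \ Z := fun h' => Finset.notMem_erase a U (Finset.mem_sdiff.mp h').1
      by_cases hle : Z ⊆ U.erase a ∧ c ∈ W'
      · rw [if_pos ((pexpo_le_iff _ _ _ _).mpr ⟨hle.1, Finset.singleton_subset_iff.mpr hle.2⟩), if_pos hle,
          pexpo_sub _ _ _ _ hle.1 (Finset.singleton_subset_iff.mpr hle.2), Finset.sdiff_singleton_eq_erase,
          coeff_killVars_symbolicWitness_of_not_mem s h a _ haZ]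
      · rw [if_neg, if_neg hle]
        intro h'
        exact hle (((pexpo_le_iff _ _ _ _).mp h').imp_right Finset.singleton_subset_iff.mp)
    · rw [Finsupp.mem_support_iff, pexpo_castAdd_of_mem W' haU]; exact one_ne_zero
    · rw [pexpo_castAdd_of_mem W' haU]; omega
  · rw [if_neg haU, coeff_X_mul', if_neg, coeff_X_pow_mul', if_neg, add_zero, add_zero, hF₀,
      coeff_killVars_symbolicWitness_of_not_mem s h a W' haU]
    · rw [pexpo_castAdd_of_not_mem W' haU]; omega
    · rw [Finsupp.mem_support_iff, pexpo_castAdd_of_not_mem W' haU]; exact fun h0 => h0 rfl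

/-! ## 4. The LEF move -/

/-- **The LEF (partner) move.** If the LEF layout matrix at `(a, π)` is nonsingular then the symbolic anchored minor is nonzero
(every `s ≥ 1`, every `h`, any `π`). -/
theorem symbolicDet_ne_zero_of_lef (s h r : ℕ) (hs : 1 ≤ s) (u w : Fin r → Finset (Fin h)) (a : Fin h) (π : Fin h → Fin h)
    (hL : (Matrix.of fun i j : Fin r => lefEntry a π s (u i) (w j)).det ≠ 0) :
    symbolicDet s h r u w ≠ 0 := by
  intro hzero
  apply hL
  have h1 : symbolicDet s h r u w =
      (Matrix.of fun i j : Fin r => coeff (pexpo (u i) (w j)) (symbolicWitness s h)).det := rfl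
  have h2 : (Matrix.of fun i j : Fin r => lefEntry a π s (u i) (w j)) =
      (lefHom a π).mapMatrix (Matrix.of fun i j : Fin r => coeff (pexpo (u i) (w j)) (symbolicWitness s h)) := by
    ext i j
    rw [RingHom.mapMatrix_apply, Matrix.map_apply, Matrix.of_apply, Matrix.of_apply, ← coeff_map, coeff_map_lefHom a π hs]
  rw [h2, ← RingHom.map_det, ← h1, hzero, map_zero]

end ThinStep

end

end Summit.ValiantsHypothesis.ValiantsHypothesis.Theorems.BarrierLever.AnchoredPeeling
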